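import Mathlib.NumberTheory.NumberField.Basic
import Mathlib.NumberTheory.NumberField.InfinitePlace.TotallyRealComplex
import Mathlib.RingTheory.Ideal.Prime
import HarnessLib

/-!
# Bounded gaps between prime elements of number fields (Castillo–Hall–Lemke Oliver–Pollack–Thompson 2015)

`Literature/NumberTheory/Sieve/BoundedGapsNumberFields.lean` — named facts (D-0014) from
A. Castillo, C. Hall, R. J. Lemke Oliver, P. Pollack, L. Thompson, *Bounded gaps between primes in
number fields and function fields*, Proc. Amer. Math. Soc. 143 (2015) 2841–2856 = arXiv:1403.5808
[cite key `CastilloEtAl2015`; held as lit key paper:arxiv-1403.5808, statements verified on the text].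

## What the source prints (arXiv text, §1, §2.1, §2.3, §3.1)

* §1, conventions: "Given a number field `K` with ring of integers `𝓞_K`, we say that `α ∈ 𝓞_K` is
  prime if it generates a principal prime ideal, and we say that a `k`-tuple `(h₁, …, h_k)` of
  distinct elements of `𝓞_K` is admissible if the set `{h₁, …, h_k} mod 𝔭` is not all of `𝓞_K/𝔭` for
  each prime ideal `𝔭`."
* Theorem 1.1: "Let `m ≥ 2`. There is an integer `k₀ := k₀(m, K)` such that for any admissible
  `k`-tuple `(h₁, …, h_k)` in `𝓞_K` with `k ≥ k₀`, there are infinitely many `α ∈ 𝓞_K` such that at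
  least `m` of `α + h₁, …, α + h_k` are prime." Remark 1: "the numerology which produces `k₀` from `m`
  is similar to that in Maynard's paper, and is exactly the same if `K` is totally real. In general,
  `k₀` will depend only upon `m` and the number of complex embeddings of `K`."
* Corollary 2.6 (general `A` with primes of level of distribution `θ > 0`, admissible `k`-tuple,
  `r_k := ⌈θ M_k / 2⌉`): "There are infinitely many `α ∈ A` such that at least `r_k` of the `α + hᵢ`
  (`1 ≤ i ≤ k`) are prime." Theorem 2.7 (Hinz): "If `r₂ = 0` (i.e., `K` is totally real), the set `P`
  of primes of `𝓞_K` has level of distribution `θ` for any `θ < 1/2`." §3.1: "Suppose now that `K` is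
  totally real. By Theorem 2.7, the primes in `K` have level of distribution `θ` for any `θ < 1/2`.
  Maynard has shown that the number `M₁₀₅` in Corollary 2.6 satisfies `M₁₀₅ > 4`." Hence (Cor 2.6
  with `k = 105`, `θ` close to `1/2`: `r₁₀₅ = ⌈θ M₁₀₅/2⌉ ≥ 2`) for totally real `K` one may take
  `k₀(2, K) = 105`, as over `ℚ`; Corollary 1.2 (gaps `≤ 600` in every totally real `K`) is this with
  Engelsma's admissible `105`-tuple.

## Lean rendering

* "prime element" = Mathlib `Prime` in `𝓞 K` (a Dedekind domain: `Prime α ↔ α ≠ 0 ∧ (α) prime`),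
  matching "generates a principal prime ideal" for `α ≠ 0`.
* "admissible" = for every prime ideal `P` of `𝓞 K` some residue class `a mod P` is missed by `H`
  (`∃ a, ∀ h ∈ H, a − h ∉ P`). The quantifier also ranges over `P = ⊥` (prime in a domain), where the
  condition only asks for some `a ∉ H` — vacuous extra content (harmless).
* A `k`-tuple of distinct elements = `H : Finset (𝓞 K)`; "`k ≥ 105`" = `105 ≤ H.card`. Passing from
  `k = 105` (what §3.1 literally yields) to `k ≥ 105`: an admissible `H` with `|H| ≥ 105` contains an
  admissible `105`-element sub-tuple, and two primes in a translate of the sub-tuple are two primes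
  in the same translate of `H` — so the two forms are trivially equivalent.
* "at least `2` of `α + hᵢ` are prime" = `∃ h₁ ∈ H, ∃ h₂ ∈ H, h₁ ≠ h₂ ∧ Prime (α+h₁) ∧ Prime (α+h₂)`;
  "infinitely many `α`" = `Set.Infinite`.

## Use (grounding)

`castilloEtAl2015_thm_1_1_totallyReal` is, VERBATIM, the body of the route decl
`Summit.Parity.GeneralizedHardyLittlewood.Theses.UnitCliqueSymmetry.MaynardTaoTotallyReal`
(stmt-Parity-8862, the route's first crux "to be vendored as a cite-tagged Literature def and used as
hypothesis"): item = fact (by `Iff.rfl`/`id`). The route's Assembly then yields fixed-difference prime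
pairs in `ℤ[ζ_p + ζ_p⁻¹]`, `p ≥ 211`, conditionally on this fact.

## What is NOT here

No proof (named fact; the Maynard–Tao sieve over `𝓞_K` with Hinz's Bombieri–Vinogradov theorem and
Mitsui's prime number theorem is not in the tree). Not vendored: the general-signature `k₀(m, K)`,
Theorem 1.3 / 1.4 (`𝔽_q[t]`), Corollary 1.2 (gaps `≤ 600`), Hinz 1988 itself, the residue-degree-one
refinement (route crux `MaynardTaoTotallyRealDegreeOne`, not in print).
-/

namespace Literature.NumberTheory.Sieve

/-- **Castillo–Hall–Lemke Oliver–Pollack–Thompson 2015, Theorem 1.1 for totally real fields with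
`m = 2`, `k₀(2, K) = 105`** (named fact, as printed and assembled in loc. cit. §3.1 from Corollary 2.6,
Theorem 2.7 (Hinz) and Maynard's `M₁₀₅ > 4`): for every totally real number field `K` and every
admissible finite set `H ⊂ 𝓞 K` (missing a residue class modulo every prime ideal) with `|H| ≥ 105`,
there are infinitely many `α ∈ 𝓞 K` such that `α + h₁` and `α + h₂` are both prime elements
(generate prime ideals) for two distinct `h₁, h₂ ∈ H`. Grounds (verbatim)
`Summit.Parity.GeneralizedHardyLittlewood.Theses.UnitCliqueSymmetry.MaynardTaoTotallyReal`.
Users take `(h : castilloEtAl2015_thm_1_1_totallyReal)`.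
[cite: CastilloEtAl2015, Theorem 1.1 with Remark 1; Corollary 2.6, Theorem 2.7 and §3.1 (k₀(2,K) = 105 for K totally real)] -/
def castilloEtAl2015_thm_1_1_totallyReal : Prop :=
  ∀ (K : Type) [Field K] [NumberField K] [NumberField.IsTotallyReal K]
    (H : Finset (NumberField.RingOfIntegers K)), 105 ≤ H.card →
    (∀ P : Ideal (NumberField.RingOfIntegers K), P.IsPrime →
      ∃ a : NumberField.RingOfIntegers K, ∀ h ∈ H, a - h ∉ P) →
    {α : NumberField.RingOfIntegers K |
      ∃ h₁ ∈ H, ∃ h₂ ∈ H, h₁ ≠ h₂ ∧ Prime (α + h₁) ∧ Prime (α + h₂)}.Infinite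

end Literature.NumberTheory.Sieve
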